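import Summits.CriticalPhenomena.PercolationContinuityZ3.Theorems.PercNearOneGluingNoHeavyQuantGatedSliceMixLawPrime
import Summits.CriticalPhenomena.PercolationContinuityZ3.Theorems.PercNearOneGluingNoHeavyQuantFlowAtTMonotone
import Summits.CriticalPhenomena.PercolationContinuityZ3.Theorems.PercNearOneGluingNoHeavyQuantFlowPieces
import Summits.CriticalPhenomena.PercolationContinuityZ3.Theorems.PercNearOneGluingNoHeavyQuantLawDecFlowsDecomposition
import HarnessLib

/-!
# QUANT lane R8, T-DEC, leg (III), blob case — the MIXTURE SIDE of `LawDec.GatedSliceMixLaw'`: the EXCHANGE LEMMA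
# (a mixture `θ·W + (1−θ)·P` is flow-feasible as soon as `W` with some zero mass exported and some donor mass imported, and `P` with the
# donor mass exported and the zero mass imported, both are), pair / point flows, the explicit 5-atom form of the moved two-point law, and
# the wrapper turning a flow of the mixture into the conclusion of `GatedSliceMixLaw'`

builds on p205010 (kernel theorem, internal audit signed; external expert review pending)

Support file (`--supports stmt-CriticalPhenomena-4575`), QUANT lane typer seat prim-quant-stmt (gen 30), rung R8 of
`run/shared/lean/prim/quant/LADDER.md`.  Memo `run/shared/lean/prim/quant/prim-quant-stmt-g30/MIXLAW-MIXTURES-G30.md`.  Theorems only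
(no definitions), standard axioms, no sorries.

THE MECHANISM (memo §1–§3; exact census of the seat, ≈ 3 000 genuine instances / 0 exceptions).  In every instance of `GatedSliceMixLaw'`
in which neither the weak-mid law `W = W_h` nor the moved two-point law `P = P[μ₂]` is DEC, ONE cross mechanism makes a mixture DEC: the
NONZERO lows of `P` (the shifted low `k₁ + a`, and `k₁`) ride the mids `h`, `h + a` of `W` — cheap for them (`usage` decreases in the low) and
dear for the zero — while the zero mass of `W` rides the giants of `P`.  Formally (`flowAtT_mixture_of_exchange`): if
`W' := W − e·δ₀ + Σ_ℓ k_ℓ·δ_ℓ` and `P' := P + ρe·δ₀ − ρ·Σ_ℓ k_ℓ·δ_ℓ` are both `FlowAtT` and `θ = ρ/(1+ρ)`, then `θ·W + (1−θ)·P = θ·W' + (1−θ)·P'`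
pointwise is `FlowAtT` (`FlowAtT` is a convex cone: `FlowAtT.add`, `FlowAtT.smul`).  The `W`-part is certified by explicit PAIR FLOWS
(`flowAtT_pair`), the `P`-part by criterion E (`flowAtT_of_giants`) — see the regime files `…QuantGatedSliceMixLawC1` ff., where `ρ` is taken
at the BALANCE POINT (the donated lows exactly fill `W`'s mids) and the whole conclusion becomes ONE inequality "the zeros fit the giants".

* `LawDec.flowAtT_pair`, `LawDec.flowAtT_point` — one compatible pair / one non-low atom is flow-feasible.
* `LawDec.flowAtT_mixture_of_exchange` — the exchange lemma.
* `LawDec.movedTwoPoint_apply` — `z·δ₀ + (1−z)·slice {k₁,k₂;λ} a g` is the explicit 5-atom law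
  `z·δ₀ + (1−z)(1−λ)(1−g)·δ_{k₁} + (1−z)(1−λ)g·δ_{k₁+a} + (1−z)λ(1−g)·δ_{k₂} + (1−z)λg·δ_{k₂+a}`; `sum_movedTwoPoint`, `movedTwoPoint_eq_zero`.
* `LawDec.gatedSliceMixLaw_conclusion_of_flowAtT` — a flow of the mixture at some `0 ≤ θ < 1` gives the `∃ θ` conclusion of
  `GatedSliceMixLaw'` (`decAtT_of_flowAtT`).

[this work]; flow form / cone / criterion E: prim-quant-stmt g22–g27, census-2 g54, arm-1 g39 (this lane).  Nothing here is cited as a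
published result.  The gluing rows served [cite: KozmaNitzan2024, Conjecture 3 (p. 15)]; product measure [cite: Grimmett1999, §1.3 p. 10].
-/

noncomputable section

namespace Summit.CriticalPhenomena.PercolationContinuityZ3.Theorems

namespace Quant

open Finset

/-- the two-point law `{lo, hi; g}` (as in `…QuantLawDEC`) -/
local notation3 "TP[" lo ", " hi ", " g ", " h "]" =>
  (g : ℝ) * (if (h : ℕ) = (hi : ℕ) then (1 : ℝ) else 0) + (1 - (g : ℝ)) * (if (h : ℕ) = (lo : ℕ) then (1 : ℝ) else 0)

namespace LawDec

/-! ### Pair and point flows -/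

/-- **one compatible pair is flow-feasible**: a low `l` (`l ≤ j′`, `2l < T`) of mass `A ≥ 0` and an absorber `m ≤ M`
(`m ≥ j′+1` or `T ≤ 2m`) compatible with it (`m ≥ j′+1` or `T < l + m`) of mass `B ≥ usage(l,m)·A`. [this work] -/
theorem flowAtT_pair (x T : ℝ) (j' M l m : ℕ) (A B : ℝ) (hl : l ≤ j') (hlow : 2 * (l : ℝ) < T) (hmM : m ≤ M)
    (habs : j' + 1 ≤ m ∨ T ≤ 2 * (m : ℝ)) (hcomp : j' + 1 ≤ m ∨ T < (l : ℝ) + m) (hA : 0 ≤ A)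
    (hB : usage x T j' l m * A ≤ B) :
    FlowAtT x T j' M (fun p => A * (if p = l then (1 : ℝ) else 0) + B * (if p = m then (1 : ℝ) else 0)) := by
  classical
  have hml : m ≠ l := by
    rintro rfl
    rcases habs with h1 | h2
    · omega
    · linarith
  refine ⟨fun l' h' => if l' = l ∧ h' = m then A else 0, fun l' h' => ?_, fun l' h' hp => ?_, fun l' hl' hlow' => ?_,
    fun h' hh' habs' => ?_⟩
  · beta_reduce; split_ifs <;> [exact hA; exact le_rfl]
  · by_cases hc : l' = l ∧ h' = m
    · obtain ⟨rfl, rfl⟩ := hc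
      exact ⟨hl, hlow, hmM, hcomp⟩
    · simp only [if_neg hc] at hp; exact absurd hp (lt_irrefl 0)
  · dsimp only
    by_cases hll : l' = l
    · subst hll
      have e : ∀ h' ∈ Finset.range (M + 1), (if l' = l' ∧ h' = m then A else 0) = if h' = m then A else 0 := by
        intro h' _; by_cases hh : h' = m <;> simp [hh]
      rw [Finset.sum_congr rfl e, Finset.sum_ite_eq' (Finset.range (M + 1)) m, if_pos (Finset.mem_range.2 (by omega)),
        if_pos rfl, if_neg hml.symm]
      ring
    · have e : ∀ h' ∈ Finset.range (M + 1), (if l' = l ∧ h' = m then A else 0) = 0 := by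
        intro h' _; rw [if_neg (fun hc => hll hc.1)]
      rw [Finset.sum_congr rfl e, Finset.sum_const_zero, if_neg hll]
      have hlm : l' ≠ m := by
        rintro rfl
        rcases habs with h1 | h2
        · omega
        · linarith
      rw [if_neg hlm]; ring
  · dsimp only
    by_cases hhm : h' = m
    · subst hhm
      have e : ∀ l'' ∈ Finset.range (j' + 1),
          usage x T j' l'' h' * (if l'' = l ∧ h' = h' then A else 0) = if l'' = l then usage x T j' l h' * A else 0 := by
        intro l'' _; by_cases hl'' : l'' = l
        · subst hl''; simp
        · rw [if_neg (fun hc => hl'' hc.1), if_neg hl'', mul_zero]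
      rw [Finset.sum_congr rfl e, Finset.sum_ite_eq' (Finset.range (j' + 1)) l, if_pos (Finset.mem_range.2 (by omega)),
        if_neg hml, if_pos rfl]
      linarith
    · have e : ∀ l'' ∈ Finset.range (j' + 1), usage x T j' l'' h' * (if l'' = l ∧ h' = m then A else 0) = 0 := by
        intro l'' _; rw [if_neg (fun hc => hhm hc.2), mul_zero]
      rw [Finset.sum_congr rfl e, Finset.sum_const_zero, if_neg hhm]
      split_ifs <;> linarith

/-- **one non-low atom is flow-feasible**: mass `B ≥ 0` at a position `m` which is not a low (`¬(m ≤ j′ ∧ 2m < T)`). [this work] -/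
theorem flowAtT_point (x T : ℝ) (j' M m : ℕ) (B : ℝ) (habs : ¬ (m ≤ j' ∧ 2 * (m : ℝ) < T)) (hB0 : 0 ≤ B) :
    FlowAtT x T j' M (fun p => B * (if p = m then (1 : ℝ) else 0)) := by
  classical
  refine ⟨fun _ _ => 0, fun _ _ => le_rfl, fun l' h' hp => absurd hp (lt_irrefl 0), fun l' hl' hlow' => ?_, fun h' hh' habs' => ?_⟩
  · dsimp only
    rw [Finset.sum_const_zero]
    have : l' ≠ m := by rintro rfl; exact habs ⟨hl', hlow'⟩
    rw [if_neg this, mul_zero]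
  · dsimp only
    simp only [mul_zero, Finset.sum_const_zero]
    split_ifs <;> linarith

/-! ### The exchange lemma -/

/-- **THE EXCHANGE LEMMA.**  If `W'` and `P'` are flow-feasible and `θ·W + (1−θ)·P = θ·W' + (1−θ)·P'` pointwise with `0 ≤ θ ≤ 1`, then
the mixture `θ·W + (1−θ)·P` is flow-feasible (`FlowAtT` is a convex cone).  Used with `W' = W − e·δ₀ + Σ k_ℓ·δ_ℓ` (the weak-mid law with
zero mass exported and donor mass imported) and `P' = P + ρe·δ₀ − ρΣ k_ℓ·δ_ℓ`, `θ = ρ/(1+ρ)`. [this work] -/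
theorem flowAtT_mixture_of_exchange {x T : ℝ} {j' M : ℕ} {W P W' P' : ℕ → ℝ} {θ : ℝ} (hθ0 : 0 ≤ θ) (hθ1 : θ ≤ 1)
    (hW' : FlowAtT x T j' M W') (hP' : FlowAtT x T j' M P')
    (heq : ∀ p, θ * W p + (1 - θ) * P p = θ * W' p + (1 - θ) * P' p) :
    FlowAtT x T j' M (fun p => θ * W p + (1 - θ) * P p) := by
  have e : (fun p => θ * W p + (1 - θ) * P p) = fun p => θ * W' p + (1 - θ) * P' p := funext heq
  rw [e]
  exact FlowAtT.add (hW'.smul θ hθ0) (hP'.smul (1 - θ) (by linarith))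

/-! ### The moved two-point law, explicitly -/

/-- **the moved two-point law is an explicit 5-atom law**:
`z·δ₀ + (1−z)·slice {k₁,k₂;λ} a g = z·δ₀ + (1−z)(1−λ)(1−g)·δ_{k₁} + (1−z)(1−λ)g·δ_{k₁+a} + (1−z)λ(1−g)·δ_{k₂} + (1−z)λg·δ_{k₂+a}`. [this work] -/
theorem movedTwoPoint_apply (z lam g : ℝ) (a k₁ k₂ p : ℕ) :
    z * (if p = 0 then (1 : ℝ) else 0) + (1 - z) * slice (fun q => TP[k₁, k₂, lam, q]) a g p
      = z * (if p = 0 then (1 : ℝ) else 0) + (1 - z) * (1 - lam) * (1 - g) * (if p = k₁ then (1 : ℝ) else 0)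
        + (1 - z) * (1 - lam) * g * (if p = k₁ + a then (1 : ℝ) else 0)
        + (1 - z) * lam * (1 - g) * (if p = k₂ then (1 : ℝ) else 0)
        + (1 - z) * lam * g * (if p = k₂ + a then (1 : ℝ) else 0) := by
  unfold slice
  have e1 : (if a ≤ p then (lam * (if p - a = k₂ then (1 : ℝ) else 0) + (1 - lam) * (if p - a = k₁ then (1 : ℝ) else 0)) else 0)
      = lam * (if p = k₂ + a then (1 : ℝ) else 0) + (1 - lam) * (if p = k₁ + a then (1 : ℝ) else 0) := by
    by_cases hap : a ≤ p
    · rw [if_pos hap]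
      have i2 : (if p - a = k₂ then (1 : ℝ) else 0) = if p = k₂ + a then (1 : ℝ) else 0 := by
        by_cases h2 : p = k₂ + a
        · rw [if_pos h2, if_pos (by omega)]
        · rw [if_neg h2, if_neg (by omega)]
      have i1 : (if p - a = k₁ then (1 : ℝ) else 0) = if p = k₁ + a then (1 : ℝ) else 0 := by
        by_cases h1 : p = k₁ + a
        · rw [if_pos h1, if_pos (by omega)]
        · rw [if_neg h1, if_neg (by omega)]
      rw [i1, i2]
    · rw [if_neg hap, if_neg (by omega), if_neg (by omega)]; ring
  rw [e1]; ring

/-- **the moved two-point law vanishes above `k₂ + a`** (`k₁ ≤ k₂`). [this work] -/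
theorem movedTwoPoint_eq_zero (z lam g : ℝ) (a k₁ k₂ p : ℕ) (hk : k₁ ≤ k₂) (hp : k₂ + a < p) :
    z * (if p = 0 then (1 : ℝ) else 0) + (1 - z) * slice (fun q => TP[k₁, k₂, lam, q]) a g p = 0 := by
  rw [movedTwoPoint_apply, if_neg (by omega), if_neg (by omega), if_neg (by omega), if_neg (by omega), if_neg (by omega)]
  ring

/-- **a functional against the moved two-point law** on `{0..N}` (`k₂ + a ≤ N`):
`Σ_{p ≤ N} F p·P p = z·F 0 + (1−z)[(1−λ)((1−g)F k₁ + g F(k₁+a)) + λ((1−g)F k₂ + g F(k₂+a))]`. [this work] -/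
theorem sum_coef_movedTwoPoint (F : ℕ → ℝ) (z lam g : ℝ) (a k₁ k₂ N : ℕ) (hk : k₁ ≤ k₂) (hN : k₂ + a ≤ N) :
    ∑ p ∈ Finset.range (N + 1), F p * (z * (if p = 0 then (1 : ℝ) else 0) + (1 - z) * slice (fun q => TP[k₁, k₂, lam, q]) a g p)
      = z * F 0 + (1 - z) * ((1 - lam) * ((1 - g) * F k₁ + g * F (k₁ + a)) + lam * ((1 - g) * F k₂ + g * F (k₂ + a))) := by
  have e : ∀ p ∈ Finset.range (N + 1),
      F p * (z * (if p = 0 then (1 : ℝ) else 0) + (1 - z) * slice (fun q => TP[k₁, k₂, lam, q]) a g p)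
        = z * (F p * (if p = 0 then (1 : ℝ) else 0)) + (1 - z) * (1 - lam) * (1 - g) * (F p * (if p = k₁ then (1 : ℝ) else 0))
          + (1 - z) * (1 - lam) * g * (F p * (if p = k₁ + a then (1 : ℝ) else 0))
          + (1 - z) * lam * (1 - g) * (F p * (if p = k₂ then (1 : ℝ) else 0))
          + (1 - z) * lam * g * (F p * (if p = k₂ + a then (1 : ℝ) else 0)) := by
    intro p _; rw [movedTwoPoint_apply]; ring
  rw [Finset.sum_congr rfl e]
  simp only [Finset.sum_add_distrib, ← Finset.mul_sum]
  rw [sum_mul_indicator F N 0 (by omega), sum_mul_indicator F N k₁ (by omega), sum_mul_indicator F N (k₁ + a) (by omega),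
    sum_mul_indicator F N k₂ (by omega), sum_mul_indicator F N (k₂ + a) hN]
  ring

/-- the moved two-point law has mass `1` on `{0..N}` (`k₂ + a ≤ N`). [this work] -/
theorem sum_movedTwoPoint (z lam g : ℝ) (a k₁ k₂ N : ℕ) (hk : k₁ ≤ k₂) (hN : k₂ + a ≤ N) :
    ∑ p ∈ Finset.range (N + 1), (z * (if p = 0 then (1 : ℝ) else 0) + (1 - z) * slice (fun q => TP[k₁, k₂, lam, q]) a g p) = 1 := by
  have := sum_coef_movedTwoPoint (fun _ => (1 : ℝ)) z lam g a k₁ k₂ N hk hN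
  simp only [one_mul] at this
  rw [this]; ring

/-! ### From a flow of the mixture to the conclusion of `GatedSliceMixLaw'` -/

/-- **a flow of the mixture `θ·W_h + (1−θ)·P[μ₂]` at some `0 ≤ θ < 1` yields the conclusion of `GatedSliceMixLaw'`** (`0 < y < 1`,
`h ≤ M`, `k₁ ≤ k₂ ≤ M`): the mixture is a law of mass `1` on `{0..M+a}` vanishing above `M + a`, so `decAtT_of_flowAtT` applies. [this work] -/
theorem gatedSliceMixLaw_conclusion_of_flowAtT (y z g S lam θ : ℝ) (a j M h k₁ k₂ : ℕ) (hy0 : 0 < y) (hy1 : y < 1)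
    (hhM : h ≤ M) (hk : k₁ ≤ k₂) (hk₂M : k₂ ≤ M) (hθ0 : 0 ≤ θ) (hθ1 : θ < 1)
    (hflow : FlowAtT y (S + (a : ℝ) * g * (1 - z)) j (M + a)
      (fun p => θ * weakMidLaw S g h a p
        + (1 - θ) * (z * (if p = 0 then (1 : ℝ) else 0) + (1 - z) * slice (fun q => TP[k₁, k₂, lam, q]) a g p))) :
    ∃ θ : ℝ, 0 ≤ θ ∧ θ < 1 ∧
      DECAtT y (S + (a : ℝ) * g * (1 - z)) j (M + a)
        (fun p => θ * weakMidLaw S g h a p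
          + (1 - θ) * (z * (if p = 0 then (1 : ℝ) else 0) + (1 - z) * slice (fun q => TP[k₁, k₂, lam, q]) a g p)) := by
  refine ⟨θ, hθ0, hθ1, decAtT_of_flowAtT y _ j (M + a) _ hy0 hy1 (fun p hp => ?_) ?_ hflow⟩
  · rw [weakMidLaw_eq_zero S g h a p (by omega), movedTwoPoint_eq_zero z lam g a k₁ k₂ p hk (by omega)]; ring
  · have e : ∀ p ∈ Finset.range (M + a + 1),
        θ * weakMidLaw S g h a p + (1 - θ) * (z * (if p = 0 then (1 : ℝ) else 0) + (1 - z) * slice (fun q => TP[k₁, k₂, lam, q]) a g p)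
          = θ * weakMidLaw S g h a p
            + (1 - θ) * (z * (if p = 0 then (1 : ℝ) else 0) + (1 - z) * slice (fun q => TP[k₁, k₂, lam, q]) a g p) := fun _ _ => rfl
    rw [Finset.sum_add_distrib, ← Finset.mul_sum, ← Finset.mul_sum, sum_weakMidLaw S g h a (M + a) (by omega),
      sum_movedTwoPoint z lam g a k₁ k₂ (M + a) hk (by omega)]
    ring

end LawDec

end Quant

end Summit.CriticalPhenomena.PercolationContinuityZ3.Theorems
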